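import Literature.NumberTheory.Automorphic.RankinSelbergUnfoldedEulerCuspidalPairs
import Literature.NumberTheory.Automorphic.WhittakerCoeffTranslateUnramified
import Literature.NumberTheory.Automorphic.RankinSelbergTorusPairTranslate
import Literature.NumberTheory.Automorphic.ThinTestFunction
import HarnessLib

/-!
# `Ψ(s; W_φ, W̄_{φ'}, Φ) = w_s(τ) · L^{S'}(s, π × \bar{π'}) · Ψ^τ_{S'}(s)` for a THIN test function and an
# additive character of arbitrary conductor off `S'`

Topic `NumberTheory/Automorphic`; namespace `Literature.NumberTheory.Automorphic`. Proof file (theorems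
only). The Euler factorisation of the unfolded Rankin–Selberg integral of a pair of smoothed cusp forms
in the two generalities already in the tree, combined:
`rankinSelbergTorusPairIntegralC_whittakerCoeff_eq_partialPairL_mul_translate`
(`RankinSelbergUnfoldedEulerCuspidalPairsTranslate`: Tate's character of any conductor off `S'`, the
`S'`-part translated by a torus element `τ` realising the Whittaker shifts) and
`rankinSelbergTorusPairIntegralC_whittakerCoeff_thin_eq_partialPairL_mul`
(`RankinSelbergUnfoldedEulerCuspidalPairsThin`: the thin test function
`thinTestFun n K Φ_∞ T m = Φ_∞ ⊗ ⊗_{v ∈ T} 𝟙_{e_n + 𝔭_v^m 𝒪_vⁿ} ⊗ 𝟙_{𝒪̂ⁿ}` for `T ⊆ S'`). For `re s > 1`,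

  `Ψ(s; W_φ, W̄_{φ'}, Φ) = w_s(τ) · partialPairL S' α γ̄ s · ∫_{B({v ∉ S'}) × K} W^τ_φ W̄^τ_{φ'} Φ(e_n ·) |det|^s δ_B⁻¹`

(`rankinSelbergTorusPairIntegralC_whittakerCoeff_thin_eq_partialPairL_mul_translate`): the proof of the
translated theorem verbatim, the thin test function being spherical at the places off `T ⊆ S'`
(`isLastRowSphericalAt_thinTestFun`). This is the unramified computation in the shape needed for the
bad-place treatment of Corollaire (i)(b) of Mœglin–Waldspurger (test function supported near `e_n` at
the bad places: Jacquet–Piatetski-Shapiro–Shalika (1983), (2.7); Cogdell (2004), §3.1, §4.1).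

## References

* H. Jacquet, I. I. Piatetski-Shapiro, J. A. Shalika, *Rankin–Selberg convolutions*, Amer. J. Math.
  105 (1983), §2, (2.7) [JacquetPiatetskiShapiroShalika1983].
* J. W. Cogdell, *Analytic theory of L-functions for GL_n* (2004), §2.3 Thm. 2.2, §3.1, Thm. 3.3, §4.1
  [CogdellAnalyticTheory2004].
* H. Jacquet, J. A. Shalika, *On Euler products and the classification of automorphic representations
  I*, Amer. J. Math. 103 (1981), §2, §4, (5.1) [JacquetShalikaAJM1981].
-/

noncomputable section

open MeasureTheory Measure NumberField IsDedekindDomain Matrix Set Filter Finset Topology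
open scoped MatrixGroups ENNReal NNReal ComplexConjugate Pointwise
open Literature.RingTheory.SymmetricFunctions.SymmPoly
open Literature.NumberTheory.GaloisRepresentations (ideleGroup localUnits)

namespace Literature.NumberTheory.Automorphic

section Cuspidal

open ValuativeRel

variable {n : ℕ} {K : Type} [Field K] [NumberField K]
  {μ : Measure (AdelicGroupData.gl n K).automorphicQuotient} [(AdelicGroupData.gl n K).IsAutomorphicMeasure μ]
variable [MeasurableSpace ↥(adelicUnipotent n K)] [BorelSpace ↥(adelicUnipotent n K)]
  [MeasurableConstSMul ↥(rationalUnipotent n K) ↥(adelicUnipotent n K)]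
  {ν : Measure ↥(adelicUnipotent n K)} [IsFiniteMeasureOnCompacts ν]
  [SMulInvariantMeasure ↥(rationalUnipotent n K) ↥(adelicUnipotent n K) ν] [ν.IsMulRightInvariant]
  {𝓕 : Set ↥(adelicUnipotent n K)} {ψ : AddChar (AdeleRing (𝓞 K) K) Circle}
variable [MeasurableSpace (ideleGroup K)] [BorelSpace (ideleGroup K)]

-- the house local instances of `RankinSelbergUnfoldedEulerCuspidalPairs` (Borel structures of `GL_n(𝔸_K)` in
-- both spellings, second countability of `𝔸_Kˣ`); none overrides a Mathlib instance
attribute [local instance] adelicBorel borelSpace_adelic locallyCompactSpace_adelic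
  secondCountableTopology_gl_adelic secondCountableTopology_ideleGroup glAdeleBorel borelSpace_glAdele

/-- **`Ψ(s; W_φ, W̄_{φ'}, Φ) = w_s(τ) · L^{S'}(s, α ⊗ γ̄) · Ψ^τ_{S'}(s)` on `re s > 1` for the THIN test
function and `ψ` of any conductor off `S'`.** Let `π`, `π'` be cuspidal automorphic representations of
`GL_n(𝔸_K)` (`0 < n`) with Satake families `α`, `γ` off `S`, `f ∈ π`, `f' ∈ π'`, `η` a continuous
compactly supported left `K(𝔫₀)`-invariant weight, `φ = invQuot (S_η f)`, `φ' = invQuot (S_η f')`, `W`,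
`W'` their global Whittaker coefficients (relatively compact measurable fundamental domain `𝓕`, global
character `ψ`), `Φ = thinTestFun n K Φ_∞ T m` with `Φ_∞ ≥ 0` and `g ↦ Φ(e_n g)` measurable,
`S' ⊇ S ∪ T` with `v ∤ 𝔫₀` off `S'`, and `τ ∈ (𝔸_Kˣ)ⁿ` with last entry `1` such that for every `v ∉ S'`
the `v`-component of `diag(τ)` is `diag(d)` with constant ratios `a` and `ψ_v(a ·)` of conductor `𝒪_v`.
For `re s > 1`, if the two real unfolded integrals of `W`, `W'` at `re s` are finite, then
`Ψ(s; W, W̄', Φ) = w_s(τ) · partialPairL S' α γ̄ s · ∫_{B({v ∉ S'}) × K} I_s(W(diag τ ·), W̄'(diag τ ·))`.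
[cite: JacquetPiatetskiShapiroShalika1983, §2 (2.7)] [cite: CogdellAnalyticTheory2004, §2.3 Thm. 2.2, §3.1 Thm. 3.3]
[cite: JacquetShalikaAJM1981, §4 (5.1)] -/
theorem rankinSelbergTorusPairIntegralC_whittakerCoeff_thin_eq_partialPairL_mul_translate (hn : 0 < n)
    (P Q : CuspidalAutomorphicRepGL n K μ) {S : Set (HeightOneSpectrum (𝓞 K))} {α γ : SatakeFamily K}
    (hα : IsSatakeFamilyOf P S α) (hγ : IsSatakeFamilyOf Q S γ) {𝔫₀ : Ideal (𝓞 K)} (h𝔫₀ : 𝔫₀ ≠ 0)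
    {η : (AdelicGroupData.gl n K).Adelic → ℝ} (hη : Continuous η) (hηs : HasCompactSupport η)
    (hηK : ∀ k : (AdelicGroupData.gl n K).Adelic, k ∈ principalCongruenceLevel n K 𝔫₀ →
      ∀ g : (AdelicGroupData.gl n K).Adelic, η (k * g) = η g)
    (f : P.1.toSubmodule) (f' : Q.1.toSubmodule)
    (h𝓕 : IsFundamentalDomain ↥(rationalUnipotent n K) 𝓕 ν) (h𝓕m : MeasurableSet 𝓕)
    (h𝓕c : IsCompact (closure 𝓕)) (hψ : IsGlobalAddChar K ψ)
    {T : Finset (HeightOneSpectrum (𝓞 K))} (m : ℕ)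
    {S' : Set (HeightOneSpectrum (𝓞 K))} (hSS' : S ⊆ S') (hTS' : (↑T : Set (HeightOneSpectrum (𝓞 K))) ⊆ S')
    (hGood : ∀ v ∉ S', ¬ v.asIdeal ∣ 𝔫₀)
    (τ : Fin n → ideleGroup K) (hτ : lastEntry τ = 1)
    (hτψ : ∀ v ∉ S', ∃ (d : Fin n → (v.adicCompletion K)ˣ) (a : (v.adicCompletion K)ˣ),
      localComponent v (glDiagonal n (AdeleRing (𝓞 K) K) τ) = diagonalGL (Fin n) (v.adicCompletion K) d ∧
      (∀ i j : Fin n, (i : ℕ) + 1 = j → (d i : v.adicCompletion K) * ((d j)⁻¹ : (v.adicCompletion K)ˣ) = a) ∧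
      (∀ c ∈ 𝒪[v.adicCompletion K], ψ.adicComponent v (a * c) = 1) ∧
      ∀ ϖ : v.adicCompletion K, Valued.v ϖ = WithZero.exp (-1 : ℤ) →
        ∃ c ∈ 𝒪[v.adicCompletion K], ψ.adicComponent v (a * (ϖ⁻¹ * c)) ≠ 1)
    {x y : HeightOneSpectrum (𝓞 K) → Fin n → ℂ}
    (hx : ∀ v ∉ S', (Finset.univ : Finset (Fin n)).val.map (x v) = α v)
    (hy : ∀ v ∉ S', (Finset.univ : Finset (Fin n)).val.map (y v) = γ v)
    {Φinf : (Fin n → InfiniteAdeleRing K) → ℝ} (hΦinf : ∀ z, 0 ≤ Φinf z)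
    (hΦm : Measurable fun g : GL (Fin n) (AdeleRing (𝓞 K) K) => thinTestFun n K Φinf T m (lastRow n K g))
    (νA : Measure (Fin n → ideleGroup K)) [νA.IsMulLeftInvariant] [SFinite νA]
    (νK : Measure ↥(maximalCompactAdelic n K)) [SFinite νK] {s : ℂ} (hs : 1 < s.re)
    (hfin : rankinSelbergTorusIntegral n K νA νK
      (whittakerCoeff ν 𝓕 ψ
        (invQuot (AdelicGroupData.gl n K) (smoothedForm η (f : (AdelicGroupData.gl n K).L2 μ))))
      (thinTestFun n K Φinf T m) s.re ≠ ⊤)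
    (hfin' : rankinSelbergTorusIntegral n K νA νK
      (whittakerCoeff ν 𝓕 ψ
        (invQuot (AdelicGroupData.gl n K) (smoothedForm η (f' : (AdelicGroupData.gl n K).L2 μ))))
      (thinTestFun n K Φinf T m) s.re ≠ ⊤) :
    rankinSelbergTorusPairIntegralC n K νA νK
        (whittakerCoeff ν 𝓕 ψ
          (invQuot (AdelicGroupData.gl n K) (smoothedForm η (f : (AdelicGroupData.gl n K).L2 μ))))
        (star (whittakerCoeff ν 𝓕 ψ
          (invQuot (AdelicGroupData.gl n K) (smoothedForm η (f' : (AdelicGroupData.gl n K).L2 μ)))))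
        (thinTestFun n K Φinf T m) s =
      torusWeightC n K s τ * (partialPairL S' α (fun v => (γ v).map conj) s *
        ∫ p in unitBox {v | v ∉ S'} ×ˢ Set.univ, torusPairIntegrandC n K
          (fun g => whittakerCoeff ν 𝓕 ψ
            (invQuot (AdelicGroupData.gl n K) (smoothedForm η (f : (AdelicGroupData.gl n K).L2 μ)))
            (glDiagonal n (AdeleRing (𝓞 K) K) τ * g))
          (fun g => (star (whittakerCoeff ν 𝓕 ψ
            (invQuot (AdelicGroupData.gl n K) (smoothedForm η (f' : (AdelicGroupData.gl n K).L2 μ)))))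
            (glDiagonal n (AdeleRing (𝓞 K) K) τ * g))
          (thinTestFun n K Φinf T m) s p ∂(νA.prod νK)) := by
  classical
  set φ : GL (Fin n) (AdeleRing (𝓞 K) K) → ℂ :=
    invQuot (AdelicGroupData.gl n K) (smoothedForm η (f : (AdelicGroupData.gl n K).L2 μ)) with hφ
  set φ' : GL (Fin n) (AdeleRing (𝓞 K) K) → ℂ :=
    invQuot (AdelicGroupData.gl n K) (smoothedForm η (f' : (AdelicGroupData.gl n K).L2 μ)) with hφ'
  set W : GL (Fin n) (AdeleRing (𝓞 K) K) → ℂ := whittakerCoeff ν 𝓕 ψ φ with hWdef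
  set W' : GL (Fin n) (AdeleRing (𝓞 K) K) → ℂ := whittakerCoeff ν 𝓕 ψ φ' with hW'def
  set Φ : (Fin n → AdeleRing (𝓞 K) K) → ℝ := thinTestFun n K Φinf T m with hΦdef
  set D : GL (Fin n) (AdeleRing (𝓞 K) K) := glDiagonal n (AdeleRing (𝓞 K) K) τ with hD
  -- substitute `a ↦ τ a`
  rw [rankinSelbergTorusPairIntegralC_eq_torusWeightC_mul_translate νA νK τ hτ s]
  congr 1
  -- the translated Whittaker functions are unramified torus data off `S'`
  have hex : ∀ v ∉ S', ∃ ϖ : (v.adicCompletion K)ˣ, IsTorusUnramifiedAt n K (fun g => W (D * g)) v ϖ (x v) :=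
    fun v hv => by
      obtain ⟨d, a, hT, hd, hψa, hψa'⟩ := hτψ v hv
      exact exists_isTorusUnramifiedAt_whittakerCoeff_smoothedForm_translate P hα h𝔫₀ (fun h => hv (hSS' h))
        (hGood v hv) hη hηs hηK f (hx v hv) h𝓕 h𝓕c hψ hT hd hψa hψa'
  have hex' : ∀ v ∉ S', ∃ ϖ : (v.adicCompletion K)ˣ, IsTorusUnramifiedAt n K (fun g => W' (D * g)) v ϖ (y v) :=
    fun v hv => by
      obtain ⟨d, a, hT, hd, hψa, hψa'⟩ := hτψ v hv
      exact exists_isTorusUnramifiedAt_whittakerCoeff_smoothedForm_translate Q hγ h𝔫₀ (fun h => hv (hSS' h))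
        (hGood v hv) hη hηs hηK f' (hy v hv) h𝓕 h𝓕c hψ hT hd hψa hψa'
  let ϖ : ∀ v : HeightOneSpectrum (𝓞 K), (v.adicCompletion K)ˣ := fun v =>
    if hv : v ∉ S' then Classical.choose (hex v hv) else 1
  have hW : ∀ v ∉ S', IsTorusUnramifiedAt n K (fun g => W (D * g)) v (ϖ v) (x v) := fun v hv => by
    simp only [ϖ, dif_pos hv]
    exact Classical.choose_spec (hex v hv)
  have hW' : ∀ v ∉ S', IsTorusUnramifiedAt n K (fun g => (star W') (D * g)) v (ϖ v) (star (y v)) := fun v hv => by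
    obtain ⟨ϖ', hϖ'⟩ := hex' v hv
    exact (hϖ'.of_valued_eq (hW v hv).valued_eq).star
  -- central invariance of `‖W^τ‖`
  obtain ⟨ω, hu, -, -, -, -, hcl⟩ := P.exists_centralCharacter_smoothedForm
  have hWZ0 : ∀ (z : ideleGroup K) (g : GL (Fin n) (AdeleRing (𝓞 K) K)),
      ‖W (Matrix.GeneralLinearGroup.scalar (Fin n) z * g)‖ = ‖W g‖ := fun z g => by
    rw [hWdef, whittakerCoeff_scalar_mul (fun g' => hcl η f z g') g, norm_mul, hu z, one_mul]
  have hWZ : ∀ (z : ideleGroup K) (g : GL (Fin n) (AdeleRing (𝓞 K) K)),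
      ‖W (D * (Matrix.GeneralLinearGroup.scalar (Fin n) z * g))‖ = ‖W (D * g)‖ :=
    norm_translate_scalar_mul τ hWZ0
  -- the test function
  have hT' : ∀ v ∉ S', v ∉ T := fun v hv h => hv (hTS' h)
  have hΦ0 : ∀ y, 0 ≤ Φ y := thinTestFun_nonneg hΦinf T m
  have hΦv : ∀ v ∉ S', ∀ y : Fin n → AdeleRing (𝓞 K) K, Φ y ≠ 0 → ∀ j, Valued.v ((y j).2 v) ≤ 1 :=
    fun v _ y hy j => thinTestFun_ne_zero_valued_le_one hy j v
  -- integrability of the complex pair integrand, then of the translated one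
  have hWc : Continuous W := continuous_whittakerCoeff h𝓕m h𝓕c hψ.continuous
    (continuous_invQuot_smoothedForm hη hηs _)
  have hW'c : Continuous W' := continuous_whittakerCoeff h𝓕m h𝓕c hψ.continuous
    (continuous_invQuot_smoothedForm hη hηs _)
  have hW'sc : Continuous (star W') := hW'c.star
  haveI : SecondCountableTopology (GL (Fin n) (AdeleRing (𝓞 K) K)) :=
    secondCountableTopology_generalLinearGroup_adeleRing K (Fin n)
  haveI : SecondCountableTopology (AdelicGroupData.gl n K).Adelic :=
    secondCountableTopology_generalLinearGroup_adeleRing K (Fin n)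
  haveI : SecondCountableTopology ↥(maximalCompactAdelic n K) := TopologicalSpace.Subtype.secondCountableTopology _
  have hpt : Measurable (torusPoint n K) := continuous_torusPoint.measurable
  have hmeas : Measurable (torusPairIntegrandC n K W (star W') Φ s) :=
    measurable_torusPairIntegrandC (hWc.measurable.comp hpt) (hW'sc.measurable.comp hpt) (hΦm.comp hpt) s
  have hfin'' : rankinSelbergTorusIntegral n K νA νK (star W') Φ s.re ≠ ⊤ := by
    rw [rankinSelbergTorusIntegral_star]; exact hfin'
  have hint0 : Integrable (torusPairIntegrandC n K W (star W') Φ s) (νA.prod νK) :=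
    integrable_torusPairIntegrandC νA νK hΦ0 hmeas.aestronglyMeasurable (measurable_torusIntegrand hWc hΦm s.re)
      (measurable_torusIntegrand hW'sc hΦm s.re) hfin hfin''
  have hint : Integrable (torusPairIntegrandC n K (fun g => W (D * g)) (fun g => (star W') (D * g)) Φ s)
      (νA.prod νK) :=
    integrable_torusPairIntegrandC_translate νA νK τ hτ hint0
  -- finiteness of the real torus sums at `re s` from the Satake bound
  have hSv : ∀ v ∉ S', v ∉ S := fun v hv h => hv (hSS' h)
  have hy' : ∀ v ∉ S', (Finset.univ : Finset (Fin n)).val.map (star (y v)) = (γ v).map conj := fun v hv => by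
    rw [← hy v hv, Multiset.map_map]
    rfl
  have hTx : ∀ v ∉ S', schurSelfSum (x v) ((v.residueCard : ℝ) ^ (-s.re)) ≠ ⊤ := fun v hv =>
    schurSelfSum_ne_top_of_norm_satakeParameter_le_sqrt norm_satakeParameter_le_sqrt_holds P hα
      (hSv v hv) (x v) (hx v hv) hs
  have hTy : ∀ v ∉ S', schurSelfSum (star (y v)) ((v.residueCard : ℝ) ^ (-s.re)) ≠ ⊤ := fun v hv =>
    schurSelfSum_ne_top_of_norm_satakeParameter_le_sqrt norm_satakeParameter_le_sqrt_holds Q.conj hγ.conj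
      (hSv v hv) (star (y v)) (hy' v hv) hs
  -- the Euler product of the local factors
  have hL := hasProd_partialPairL JacquetShalika1981_multipliable_partialPairL_holds P Q.conj (hα.mono hSS')
    (hγ.mono hSS').conj hs
  exact rankinSelbergTorusPairIntegralC_eq_mul_setIntegral_of_hasProd νA νK hn hW hW' hWZ
    (fun v hv => isLastRowSphericalAt_thinTestFun Φinf m (hT' v hv)) hΦv hΦ0 hint hTx hTy hx hy' hL

end Cuspidal

end Literature.NumberTheory.Automorphic
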